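import Summits.KontsevichZagierPeriods.KontsevichZagierPeriods.Theses.TerasomaMultiplication
import Summits.KontsevichZagierPeriods.KontsevichZagierPeriods.Theorems.TerasomaMultiplicationMultiplicationAccessibleCornerStokesYFibreDeriv
import Summits.KontsevichZagierPeriods.KontsevichZagierPeriods.Theorems.TerasomaMultiplicationMultiplicationAccessibleCornerStokesTheta1Aux
import Literature.NumberTheory.Transcendental.KZHomotopyMoves
import Literature.NumberTheory.Transcendental.SemialgebraicRpow
import Literature.NumberTheory.Transcendental.SemialgebraicLineDeriv
import Literature.NumberTheory.Transcendental.KZLogCalculusProofs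

/-!
# `MultiplicationAccessible` (stmt-KontsevichZagierPeriods-12305), line `shifted-family-prime-sieve`:
the `y`-derivative of the corner Stokes component `c₂` is semialgebraic and bounded (`p = 3`)

Registered sub-goal `cornerStokesYAux` of the crux `stub_gmThreeShifted` (Liouville rotation flow /
corner Stokes, design of the lead): on the chart domain
`W = {(θ₁, θ₂, y, v) | θ's > 0, θ₁ + θ₂ < 1, y > 0, yθ_k < 1, 0 < v < 1}` the component
`c₂ = P · (θ₀M₀ + θ₁M₁ + θ₂M₂)` of the closed 3-form has a `y`-partial derivative `d` which is
`ℚ`-semialgebraic on `W` (partial derivatives of semialgebraic functions are semialgebraic,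
`IsSemialgebraicFunOn.of_hasLineDerivAt`, Basu–Pollack–Roy Prop. 3.22) and bounded on `W`
(the one-variable analysis `CornerY.fibre`; `W` is semialgebraic and open:
`CornerTheta1.isSemialgebraic_W`, `CornerTheta1.isOpen_W` of the `θ₁`-move).  Also recorded for the
move itself (`cornerStokesY`): `c₂` is `ℚ`-semialgebraic on every semialgebraic set on which its
bases have the right signs (closed bands included).

References: M. Kontsevich, D. Zagier, *Periods* (2001), §1.2 rule (3); S. Basu, R. Pollack,
M.-F. Roy, *Algorithms in Real Algebraic Geometry* (2006), Prop. 3.22.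
-/

noncomputable section

open MeasureTheory Set Real
open scoped Topology
open Literature.NumberTheory.Transcendental
open Literature.NumberTheory.Transcendental.KZ
open Literature.ModelTheory.ExponentialFields (IsSemialgebraic isSemialgebraic_setOf_eval_pos
  isSemialgebraic_setOf_eval_lt)
open MvPolynomial (aeval X C)

namespace Summit.KontsevichZagierPeriods.TerasomaMultiplication.MultiplicationAccessible

namespace CornerY

/-- **`c₂` is `ℚ`-semialgebraic** on every `ℚ`-semialgebraic set on which the box coordinates are
non-negative, `S ≠ 0`, `H ≥ 0`, `v ≥ 0`, `1 - vζ ≥ 0` and `θ₀θ₁θ₂ ≥ 0`: an explicit composite of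
polynomials, rational powers (`IsSemialgebraicFunOn.rpow_ratCast_of_nonneg`) and one quotient.
[cite: BochnakCosteRoy1998, Prop. 2.2.6] -/
theorem isSemialgebraicFunOn_c2 {x s : ℚ} (hx : 2 ≤ x) (hs : 3 ≤ s)
    {Z S H K M0 M1 M2 P c2 : (Fin 4 → ℝ) → ℝ}
    (hZ : ∀ w, Z w = ((1 - w 2 * (1 - w 0 - w 1)) * (1 - w 2 * w 0) * (1 - w 2 * w 1)) ^ ((1:ℝ)/3))
    (hS : ∀ w, S w = 1 - w 2 * ((1 - w 0 - w 1) * w 0 + (1 - w 0 - w 1) * w 1 + w 0 * w 1) +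
      (w 2) ^ 2 * ((1 - w 0 - w 1) * w 0 * w 1))
    (hH : ∀ w, H w = (1 + Z w + Z w ^ 2) / S w)
    (hK : ∀ w, K w = ((1 - w 0 - w 1) * w 0 * w 1) ^ ((s:ℝ) - 1))
    (hM0 : ∀ w, M0 w = (1 - w 2 * (1 - w 0 - w 1)) ^ (x:ℝ) * (1 - w 2 * w 0) ^ ((x:ℝ) - 2/3) *
      (1 - w 2 * w 1) ^ ((x:ℝ) - 1/3))
    (hM1 : ∀ w, M1 w = (1 - w 2 * (1 - w 0 - w 1)) ^ ((x:ℝ) - 1/3) * (1 - w 2 * w 0) ^ (x:ℝ) *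
      (1 - w 2 * w 1) ^ ((x:ℝ) - 2/3))
    (hM2 : ∀ w, M2 w = (1 - w 2 * (1 - w 0 - w 1)) ^ ((x:ℝ) - 2/3) * (1 - w 2 * w 0) ^ ((x:ℝ) - 1/3) *
      (1 - w 2 * w 1) ^ (x:ℝ))
    (hP : ∀ w, P w = (w 3) ^ (3 * (x:ℝ) - 1) * (1 - w 3 * Z w) ^ (3 * (s:ℝ) - 1) * H w ^ (3 * (s:ℝ)) *
      K w)
    (hc2 : ∀ w, c2 w = P w * ((1 - w 0 - w 1) * M0 w + w 0 * M1 w + w 1 * M2 w))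
    {A : Set (Fin 4 → ℝ)} (hA : IsSemialgebraic ℚ A)
    (hA' : ∀ w ∈ A, (0 ≤ 1 - w 2 * (1 - w 0 - w 1) ∧ 0 ≤ 1 - w 2 * w 0 ∧ 0 ≤ 1 - w 2 * w 1) ∧
      S w ≠ 0 ∧ 0 ≤ H w ∧ 0 ≤ w 3 ∧ 0 ≤ 1 - w 3 * Z w ∧ 0 ≤ (1 - w 0 - w 1) * w 0 * w 1) :
    IsSemialgebraicFunOn ℚ A c2 := by
  have c0 := isSemialgebraicFunOn_apply hA 0
  have c1 := isSemialgebraicFunOn_apply hA 1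
  have cy := isSemialgebraicFunOn_apply hA 2
  have cv := isSemialgebraicFunOn_apply hA 3
  have one : IsSemialgebraicFunOn ℚ A (fun _ : Fin 4 → ℝ => (1:ℝ)) :=
    isSemialgebraicFunOn_const_of_isAlgebraic hA isAlgebraic_one
  have th : IsSemialgebraicFunOn ℚ A (fun w : Fin 4 → ℝ => 1 - w 0 - w 1) := (one.fun_sub c0).fun_sub c1
  have t0 : IsSemialgebraicFunOn ℚ A (fun w : Fin 4 → ℝ => 1 - w 2 * (1 - w 0 - w 1)) :=
    one.fun_sub (cy.fun_mul th)
  have t1 : IsSemialgebraicFunOn ℚ A (fun w : Fin 4 → ℝ => 1 - w 2 * w 0) := one.fun_sub (cy.fun_mul c0)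
  have t2 : IsSemialgebraicFunOn ℚ A (fun w : Fin 4 → ℝ => 1 - w 2 * w 1) := one.fun_sub (cy.fun_mul c1)
  have ex0 : (x : ℚ) ≠ 0 := ne_of_gt (by linarith)
  have ex1 : (x - 1/3 : ℚ) ≠ 0 := ne_of_gt (by linarith)
  have ex2 : (x - 2/3 : ℚ) ≠ 0 := ne_of_gt (by linarith)
  -- rational powers of non-negative semialgebraic functions
  have pw : ∀ {f : (Fin 4 → ℝ) → ℝ}, IsSemialgebraicFunOn ℚ A f → (∀ w ∈ A, 0 ≤ f w) →
      ∀ (e : ℚ), e ≠ 0 → IsSemialgebraicFunOn ℚ A (fun w => f w ^ (e : ℝ)) :=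
    fun hf hnn e he => hf.rpow_ratCast_of_nonneg hnn he
  have m0 : IsSemialgebraicFunOn ℚ A M0 := by
    refine (((pw t0 (fun w hw => (hA' w hw).1.1) x ex0).fun_mul
      (pw t1 (fun w hw => (hA' w hw).1.2.1) (x - 2/3) ex2)).fun_mul
      (pw t2 (fun w hw => (hA' w hw).1.2.2) (x - 1/3) ex1)).congr fun w _ => ?_
    rw [hM0]; push_cast; ring_nf
  have m1 : IsSemialgebraicFunOn ℚ A M1 := by
    refine (((pw t0 (fun w hw => (hA' w hw).1.1) (x - 1/3) ex1).fun_mul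
      (pw t1 (fun w hw => (hA' w hw).1.2.1) x ex0)).fun_mul
      (pw t2 (fun w hw => (hA' w hw).1.2.2) (x - 2/3) ex2)).congr fun w _ => ?_
    rw [hM1]; push_cast; ring_nf
  have m2 : IsSemialgebraicFunOn ℚ A M2 := by
    refine (((pw t0 (fun w hw => (hA' w hw).1.1) (x - 2/3) ex2).fun_mul
      (pw t1 (fun w hw => (hA' w hw).1.2.1) (x - 1/3) ex1)).fun_mul
      (pw t2 (fun w hw => (hA' w hw).1.2.2) x ex0)).congr fun w _ => ?_
    rw [hM2]; push_cast; ring_nf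
  have z : IsSemialgebraicFunOn ℚ A Z := by
    refine (pw ((t0.fun_mul t1).fun_mul t2) (fun w hw => ?_) (1/3) (by norm_num)).congr
      fun w _ => ?_
    · obtain ⟨⟨h0, h1, h2⟩, -⟩ := hA' w hw; positivity
    · rw [hZ]; push_cast; ring_nf
  have sS : IsSemialgebraicFunOn ℚ A S :=
    (isSemialgebraicFunOn_aeval hA (1 - X 2 * ((1 - X 0 - X 1) * X 0 + (1 - X 0 - X 1) * X 1 +
      X 0 * X 1) + X 2 ^ 2 * ((1 - X 0 - X 1) * X 0 * X 1) : MvPolynomial (Fin 4) ℚ)).congr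
      fun w _ => by rw [hS]; simp
  have hHf : IsSemialgebraicFunOn ℚ A H :=
    (((one.fun_add z).fun_add (z.fun_pow 2)).div sS fun w hw => (hA' w hw).2.1).congr
      fun w _ => by rw [hH]
  have hp : IsSemialgebraicFunOn ℚ A (fun w => H w ^ (3 * (s:ℝ))) :=
    (pw hHf (fun w hw => (hA' w hw).2.2.1) (3 * s) (ne_of_gt (by linarith))).congr fun w _ => by
      push_cast; ring_nf
  have kK : IsSemialgebraicFunOn ℚ A K :=
    (pw ((th.fun_mul c0).fun_mul c1) (fun w hw => (hA' w hw).2.2.2.2.2) (s - 1)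
      (ne_of_gt (by linarith))).congr fun w _ => by rw [hK]; push_cast; ring_nf
  have vp : IsSemialgebraicFunOn ℚ A (fun w : Fin 4 → ℝ => w 3 ^ (3 * (x:ℝ) - 1)) :=
    (pw cv (fun w hw => (hA' w hw).2.2.2.1) (3 * x - 1) (ne_of_gt (by linarith))).congr fun w _ => by
      push_cast; ring_nf
  have gp : IsSemialgebraicFunOn ℚ A (fun w => (1 - w 3 * Z w) ^ (3 * (s:ℝ) - 1)) :=
    (pw (one.fun_sub (cv.fun_mul z)) (fun w hw => (hA' w hw).2.2.2.2.1) (3 * s - 1)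
      (ne_of_gt (by linarith))).congr fun w _ => by push_cast; ring_nf
  have pP : IsSemialgebraicFunOn ℚ A P :=
    (((vp.fun_mul gp).fun_mul hp).fun_mul kK).congr fun w _ => by rw [hP]
  exact (pP.fun_mul (((th.fun_mul m0).fun_add (c0.fun_mul m1)).fun_add (c1.fun_mul m2))).congr
    fun w _ => by rw [hc2]

end CornerY

/-- **The `y`-derivative of `c₂` is semialgebraic and bounded on the chart domain** (registered
sub-goal `cornerStokesYAux` of `stub_gmThreeShifted`).  Pointwise, the fibre function
`a ↦ c₂(θ₁, θ₂, a, v)` is the one-variable function of `CornerY.fibre`, which gives the derivative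
and the uniform bound `9^{3s}(1000 s + 3x)`; choosing this derivative as `d`, its
`ℚ`-semialgebraicity on the open set `W` is the semialgebraicity of partial derivatives of the
`ℚ`-semialgebraic function `c₂` (`IsSemialgebraicFunOn.of_hasLineDerivAt`).
[cite: BasuPollackRoy2006, Prop. 3.22] -/
theorem cornerStokesYAux : ∀ (x s : ℚ), 2 ≤ x → 3 ≤ s → ∀ (Z S H K M0 M1 M2 P : (Fin 4 → ℝ) → ℝ),
    (∀ w, Z w = ((1 - w 2 * (1 - w 0 - w 1)) * (1 - w 2 * w 0) * (1 - w 2 * w 1)) ^ ((1:ℝ)/3)) →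
    (∀ w, S w = 1 - w 2 * ((1 - w 0 - w 1) * w 0 + (1 - w 0 - w 1) * w 1 + w 0 * w 1) +
      (w 2) ^ 2 * ((1 - w 0 - w 1) * w 0 * w 1)) →
    (∀ w, H w = (1 + Z w + Z w ^ 2) / S w) →
    (∀ w, K w = ((1 - w 0 - w 1) * w 0 * w 1) ^ ((s:ℝ) - 1)) →
    (∀ w, M0 w = (1 - w 2 * (1 - w 0 - w 1)) ^ (x:ℝ) * (1 - w 2 * w 0) ^ ((x:ℝ) - 2/3) * (1 - w 2 * w 1) ^ ((x:ℝ) - 1/3)) →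
    (∀ w, M1 w = (1 - w 2 * (1 - w 0 - w 1)) ^ ((x:ℝ) - 1/3) * (1 - w 2 * w 0) ^ (x:ℝ) * (1 - w 2 * w 1) ^ ((x:ℝ) - 2/3)) →
    (∀ w, M2 w = (1 - w 2 * (1 - w 0 - w 1)) ^ ((x:ℝ) - 2/3) * (1 - w 2 * w 0) ^ ((x:ℝ) - 1/3) * (1 - w 2 * w 1) ^ (x:ℝ)) →
    (∀ w, P w = (w 3) ^ (3 * (x:ℝ) - 1) * (1 - w 3 * Z w) ^ (3 * (s:ℝ) - 1) * H w ^ (3 * (s:ℝ)) * K w) →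
    ∀ (c2 : (Fin 4 → ℝ) → ℝ), (∀ w, c2 w = P w * ((1 - w 0 - w 1) * M0 w + w 0 * M1 w + w 1 * M2 w)) →
    ∃ d : (Fin 4 → ℝ) → ℝ, IsSemialgebraicFunOn ℚ {w : Fin 4 → ℝ | 0 < w 0 ∧ 0 < w 1 ∧ w 0 + w 1 < 1 ∧ 0 < w 2 ∧ w 2 * (1 - w 0 - w 1) < 1 ∧ w 2 * w 0 < 1 ∧ w 2 * w 1 < 1 ∧ 0 < w 3 ∧ w 3 < 1} d ∧
      (∃ C : ℝ, ∀ w ∈ {w : Fin 4 → ℝ | 0 < w 0 ∧ 0 < w 1 ∧ w 0 + w 1 < 1 ∧ 0 < w 2 ∧ w 2 * (1 - w 0 - w 1) < 1 ∧ w 2 * w 0 < 1 ∧ w 2 * w 1 < 1 ∧ 0 < w 3 ∧ w 3 < 1}, |d w| ≤ C) ∧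
      ∀ w ∈ {w : Fin 4 → ℝ | 0 < w 0 ∧ 0 < w 1 ∧ w 0 + w 1 < 1 ∧ 0 < w 2 ∧ w 2 * (1 - w 0 - w 1) < 1 ∧ w 2 * w 0 < 1 ∧ w 2 * w 1 < 1 ∧ 0 < w 3 ∧ w 3 < 1},
        HasDerivAt (fun a => c2 (Function.update w 2 a)) (d w) (w 2) := by
  intro x s hx hs Z S H K M0 M1 M2 P hZ hS hH hK hM0 hM1 hM2 hP c2 hc2
  set W : Set (Fin 4 → ℝ) := {w : Fin 4 → ℝ | 0 < w 0 ∧ 0 < w 1 ∧ w 0 + w 1 < 1 ∧ 0 < w 2 ∧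
    w 2 * (1 - w 0 - w 1) < 1 ∧ w 2 * w 0 < 1 ∧ w 2 * w 1 < 1 ∧ 0 < w 3 ∧ w 3 < 1} with hW
  have hxR : (2:ℝ) ≤ x := by exact_mod_cast hx
  have hsR : (3:ℝ) ≤ s := by exact_mod_cast hs
  -- pointwise: the fibre derivative and its bound
  have key : ∀ w ∈ W, ∃ D, HasDerivAt (fun a => c2 (Function.update w 2 a)) D (w 2) ∧
      |D| ≤ (9:ℝ) ^ (3 * (s:ℝ)) * (1000 * (s:ℝ) + 3 * (x:ℝ)) := by
    intro w hw
    obtain ⟨h0, h1, h01, hy, hy0, hy1, hy2, hv0, hv1⟩ := hw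
    refine CornerY.fibre hxR hsR (θ₀ := 1 - w 0 - w 1) (θ₁ := w 0) (θ₂ := w 1) (v := w 3)
      (y := w 2) (by linarith) h0 h1 (by ring) hy hy0 hy1 hy2 hv0 hv1
      (fun a => Z (Function.update w 2 a)) (fun a => S (Function.update w 2 a))
      (fun a => M0 (Function.update w 2 a)) (fun a => M1 (Function.update w 2 a))
      (fun a => M2 (Function.update w 2 a)) (fun a => c2 (Function.update w 2 a))
      (fun a => ?_) (fun a => ?_) (fun a => ?_) (fun a => ?_) (fun a => ?_) (fun a => ?_)
    · simp [hZ]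
    · simp [hS]
    · simp [hM0]
    · simp [hM1]
    · simp [hM2]
    · simp [hc2, hP, hH, hK]
  choose! d hd using key
  have hWsa : IsSemialgebraic ℚ W := CornerTheta1.isSemialgebraic_W
  have hWo : IsOpen W := CornerTheta1.isOpen_W
  refine ⟨d, ?_, ⟨_, fun w hw => (hd w hw).2⟩, fun w hw => (hd w hw).1⟩
  -- `c₂` is semialgebraic on `W`
  have hc2sa : IsSemialgebraicFunOn ℚ W c2 := by
    refine CornerY.isSemialgebraicFunOn_c2 hx hs hZ hS hH hK hM0 hM1 hM2 hP hc2 hWsa fun w hw => ?_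
    obtain ⟨h0, h1, h01, hy, hy0, hy1, hy2, hv0, hv1⟩ := hw
    have hθ₀ : 0 < 1 - w 0 - w 1 := by linarith
    have ht0 : 0 < 1 - w 2 * (1 - w 0 - w 1) := by linarith
    have ht1 : 0 < 1 - w 2 * w 0 := by linarith
    have ht2 : 0 < 1 - w 2 * w 1 := by linarith
    have hp : 0 < (1 - w 2 * (1 - w 0 - w 1)) * (1 - w 2 * w 0) * (1 - w 2 * w 1) := by positivity
    have hp1 : (1 - w 2 * (1 - w 0 - w 1)) * (1 - w 2 * w 0) * (1 - w 2 * w 1) ≤ 1 := by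
      have ha : 1 - w 2 * (1 - w 0 - w 1) ≤ 1 := by have := mul_pos hy hθ₀; linarith
      have hb : 1 - w 2 * w 0 ≤ 1 := by have := mul_pos hy h0; linarith
      have hc : 1 - w 2 * w 1 ≤ 1 := by have := mul_pos hy h1; linarith
      exact mul_le_one₀ (mul_le_one₀ ha ht1.le hb) ht2.le hc
    have hZ0 : 0 ≤ Z w := by rw [hZ]; positivity
    have hZ1 : Z w ≤ 1 := by rw [hZ]; exact rpow_le_one hp.le hp1 (by norm_num)
    have hS3 : 1 / 3 ≤ S w := by
      rw [hS]
      exact CornerY.third_le_S (θ₀ := 1 - w 0 - w 1) (by ring) hθ₀.le h0.le h1.le hy.le ht0.le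
        ht1.le ht2.le
    have hvZ : 0 ≤ 1 - w 3 * Z w := by
      have := mul_le_mul_of_nonneg_left hZ1 hv0.le; linarith
    refine ⟨⟨ht0.le, ht1.le, ht2.le⟩, by linarith, ?_, hv0.le, hvZ, by positivity⟩
    rw [hH]; positivity
  refine IsSemialgebraicFunOn.of_hasLineDerivAt 2 hc2sa hWsa Subset.rfl (fun w hw => ?_)
    (fun w hw => ?_)
  · have hc : Continuous fun t : ℝ => w + t • (Pi.single 2 1 : Fin 4 → ℝ) :=
      continuous_const.add (continuous_id.smul continuous_const)
    have h0 : w + (0 : ℝ) • (Pi.single 2 1 : Fin 4 → ℝ) = w := by simp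
    exact hc.continuousAt.preimage_mem_nhds (by rw [h0]; exact hWo.mem_nhds hw)
  · have he : ∀ t : ℝ, w + t • (Pi.single 2 1 : Fin 4 → ℝ) = Function.update w 2 (w 2 + t) := by
      intro t
      ext i
      by_cases hi : i = 2
      · subst hi; simp
      · simp [hi]
    show HasDerivAt (fun t : ℝ => c2 (w + t • Pi.single 2 1)) (d w) 0
    simp_rw [he]
    exact HasDerivAt.comp_const_add (w 2) 0 (by rw [add_zero]; exact (hd w hw).1)

end Summit.KontsevichZagierPeriods.TerasomaMultiplication.MultiplicationAccessible

end
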